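import Summits.QuantumFields.BalabanUV.Gaps.D1RoadsJunctionPinned
import Literature.MathematicalPhysics.QuantumFieldTheory.Balaban1983to89.Beta.HessKerDressedCauchy

/-!
# `BalabanUV.Gaps.D1ValueSockets` — cell pub-balaban-gaps, row (D1): THE VALUE SOCKETS OF (D1) — under an all-scales rate of the step
# coefficients, (D1) ∕ `OneShotLaw` ⟺ EVERY step coefficient sits in the geometric tube about `(11N²∕12π²)·log Lc`; ONE certified coefficient
# outside the tube REFUTES (D1); the first step alone must sit within `κ` of the slope

HONEST FRAMING (cell contract, verbatim): «discharging `BetaPertH` makes Bałaban's UV stability UNCONDITIONAL — a real constructive-QFT result;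
it is NOT the continuum limit and NOT the Clay problem.»  HONEST DEPENDENCY (verbatim): «continuum YM on T⁴ ⇐ BetaPertH ∧ nine spine estimates
(0/9 proved); BetaPertH ⇐ (D1) ∧ (D4) ∧ CAP+tail; G-an2-4 gates asym, D1 and NE2/3/4.»  THIS MODULE DISCHARGES NOTHING: [folklore] sequence algebra
(`RemainderConstAllScales.AllScalesSeq.geomRate`, `RateCertificate.CauchyRate.lim_eq_of_drift`, `Drift.drift_of_geometric`) composed BY NAME with this
lineage's junction `Gaps.D1RoadsJunctionPinned.d1Drift_record_iff_oneShotLaw_of_stepRecursion_tabs` and an2's anchor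
`Beta.CombOneShotJetsTabs.TshotOf_JcOfTabs_one`.  Every all-scales rate, every step recursion and every law below is a HYPOTHESIS displayed with its
constants; nothing of Bałaban's is asserted; (D1) NOT discharged; 0∕4 row-D1 binders; NOT BetaPertH, NOT continuum, NOT Clay.  No `def`, no
`def … : Prop`, nothing cited, 0 sorry.

WHY ∕ WHAT (row (D1) of `HOME/BALABAN-GAPS.md`, G1 review «what would move the word»; the VALUE∕SIGN dichotomy next to g1-p3's CAP sockets
`Gaps/CapSignsRefutationSocket` ∕ `CapTailPinnedLimitSign` §5).  Row G-an2-4 delivers, for a step family `Js`, the shape `AllScalesSeq (j ↦ secondMoment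
(TbalOf Lc Js j) μ ν) κ θ`, `0 ≤ θ < 1` (e.g. `HessKerDressedCauchy.allScalesSeq_secondMoment_TbalOf_JsBalOf`); under it the lead's `d1Drift_iff_lim_eq` reads
(D1) as ONE identity of reals `CauchyRate.lim β⁰ = stepBal N Lc`.  This file types the FINITE-SCALE face an engine or a refuter consumes:
§1 (any real `b`): `drift_iff_forall_abs_sub_le` — `(∃ A, OneLoopDrift s A b) ↔ ∀ j, |b j − s| ≤ κ·θ^j` (⇒ SAME `κ`, the shape being two-ended; ⇐ defect
`κ∕(1−θ)`); `not_drift_of_gap` (ONE index outside the tube refutes), `mem_Icc_of_allScales_drift`; the one-ended Cauchy-rate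
currency with budget `c∕(1−θ)` (`…_of_cauchyRate`).  §2 (any `Js`): `d1Drift_iff_forall_abs_sub_stepBal_le`, THE REFUTATION SOCKET `not_d1Drift_of_gap`
(+ `_zero`, `_of_cauchyRate`), THE FIRST-STEP TEST `abs_secondMoment_zero_sub_stepBal_le_of_d1Drift` (`|β⁰_0 − (11N²∕12π²)·log Lc| ≤ κ`),
`stepBal_mem_Icc_of_d1Drift`.  §2′ (any `Jc`, no row): `tendsto_secondMoment_TshotOf_div_of_oneShotLaw` — `OneShotLaw` ⟹ `secondMoment (TshotOf Lc Jc m) μ ν ∕ m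
→ stepBal N Lc`, the engine-facing MEAN form.  §3 (the (III′) literal of record `JsB12CombShSym hLc N (symTablesAn1S2 3 Lc (cΛ 1)) (cΛ 1) (cB 1)` under the
level-1 locks, the `Jc` of record `JcOfTabs hLc N tabs cΛ cB` over ANY table record anchored on an1's at depth 1, an4's `StepRecursion` ONE hypothesis; the
junction §4 and road FP's #30d∕#31 CALLED): the EXACT read-out `sum_secondMoment_eq_secondMoment_TshotOf_of_stepRecursion` (`Σ_{j<m} β⁰_j = secondMoment
(TshotOf … m) μ ν`, U′ = 0); `abs_secondMoment_TshotOf_sub_lim_mul_le_of_stepRecursion` — THE ONE-SHOT SECOND MOMENT DRIFTS LINEARLY IN `m` WITH THE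
CONSTRUCTED SLOPE `CauchyRate.lim β⁰`, defect `κ∕(1−θ)`, UNCONDITIONALLY IN THE VALUE; hence `oneShotLaw_iff_lim_eq_of_stepRecursion` — beyond the two rows the
WHOLE content of the exact missing lemma `Gaps.D1Residue.OneShotLaw` is ONE real number; the tube `oneShotLaw_iff_forall_abs_sub_stepBal_le_of_stepRecursion`,
its socket `not_oneShotLaw_of_gap_of_stepRecursion`, THE ONE-STEP READING `abs_secondMoment_TshotOf_one_sub_stepBal_le_of_oneShotLaw` (the m = 1 one-shot
coefficient at block `Lc` within `κ` of the printed slope; an2's anchor `TshotOf_JcOfTabs_one`), and in `OneShotLaw`'s OWN currency the `∃ U` made explicit,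
`|secondMoment (TshotOf … m) μ ν − stepBal Nc Lc·m| ≤ κ∕(1−θ)` (`abs_secondMoment_TshotOf_sub_stepBal_mul_le_of_oneShotLaw`) with its socket
`not_oneShotLaw_of_oneShot_gap_of_stepRecursion` (ONE composite block `Lc^m` off by more than `κ∕(1−θ)` kills it).  §4 THE SIGN∕VALUE DICHOTOMY kernel-checked,
`exists_allScales_agree_drift_and_not_drift`: for every `κ > 0`, `0 < θ < 1`, `s`, `J`, two sequences with the same shape and the same first `J + 1` terms, one
drifting with slope `s`, one not — NO finite list of (even exact) coefficients plus the shape implies (D1); a VALUE identity is refutable, never certifiable, by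
finitely many terms (contrast the CAP SIGN list: `RateCertificate.GeomRate.smallKCert`).
WHAT THIS IS NOT (honest): (i) no engine run can DISCHARGE (D1) (§4) — it can only REFUTE it (§1–§3) or support it to tolerance; (ii) THE SOCKETS' TEETH ARE A
NUMBER (g1-plan-1 V16-1): every socket is quantified over the `κ θ` of the displayed `hall`, so `κ < |β⁰_0 − (11N²∕12π²)·log Lc|` refutes nothing until `κ` is
NUMERIC at the (III′) literal (row G-an2-4's deliverable, e.g. the closed-form `betaPrime510 4 (…)` of `allScalesSeq_secondMoment_TbalOf_JsBalOf` with numeric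
data constants; any crude upper bound will do) — not supplied here; likewise §4 is relative to the SHAPE alone — at the literal the `β⁰_j` are a determined
sequence, and a closed form (road BF-x) certifies; (iii) Engine C's float64 moments at `(d+1, Lc) = (4, 3)` are informational and not p-stable (owner's R7) —
nothing numerical enters; (iv) the discharge of (D1) is the analytic one-loop computation `OneShotLaw` (roads BF-x ∕ FP), untouched here.

ABSOLUTE RULE (cell charter, verbatim): «No internally-minted statement may enter as a cited fact. Every hypothesis is either kernel-proved in this
package or a verbatim quotation of a PUBLISHED theorem with page reference. The manuscript(s) under audit are NOT citable for their own disputed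
steps — they are the thing under adjudication; programme-internal (2001/route/tribunal) claims are never citable.»

Provenance: cell pub-balaban-gaps, seat g1-p1 GEN 7 (prover-pub-balaban-gaps-g1-p1-g7-0), 2026-08-23; imports this lineage's `Gaps.D1RoadsJunctionPinned`
(p345653 ∕ p347037) and the lead lineage's `Beta.HessKerDressedCauchy` (read-only, BY NAME); no existing file touched.
-/

noncomputable section

open Finset Filter Topology
open scoped BigOperators
open Literature.MathematicalPhysics.QuantumFieldTheory.Balaban1983to89
open Literature.MathematicalPhysics.QuantumFieldTheory.Balaban1983to89.Beta
open OneStepResolventKernel (JetData)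
open OneStepKernelFamily (TbalOf TshotOf D1Drift)
open B12Beta (secondMoment)
open RemainderConstAllScales (AllScalesSeq)
open RateCertificate (GeomRate CauchyRate)
open HessianTelescopingKKT (StepRecursion wStep)
open Summit.QuantumFields.BalabanUV.Beta.CombChartJointEnd (JsB12CombShSym)
open Summit.QuantumFields.BalabanUV.Beta.SymSecondOrderTablesAn1 (symTablesAn1S2)
open Summit.QuantumFields.BalabanUV.Beta.SymmetrisedStepJets (SymTables)
open Summit.QuantumFields.BalabanUV.Beta.CombOneShotJetsTabs (JcOfTabs TshotOf_JcOfTabs_one)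
open Summit.QuantumFields.BalabanUV.Gaps.D1Residue (OneShotLaw)
open Summit.QuantumFields.BalabanUV.Gaps.D1RoadsJunction (readout_eq_of_D1Tel_T0T1)
open Summit.QuantumFields.BalabanUV.Gaps.D1RoadsJunctionPinned (d1Drift_record_iff_oneShotLaw_of_stepRecursion_tabs)
open Summit.QuantumFields.BalabanUV.Beta.FP.StepKernelWardDataRecord (stepT0_JsB12CombShSym_an1S2_pinned stepT1_JsB12CombShSym_an1S2_pinned)
open Summit.QuantumFields.BalabanUV.Beta.FP.StepRecursionFeedTabs (d1Tel_JcOfTabs_of_stepRecursion_wStep_pinned)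
open HessKerDressedCauchy (d1Drift_iff_lim_eq oneLoopDrift_lim)

namespace Summit.QuantumFields.BalabanUV.Gaps.D1ValueSockets

/-! ## §1 Sequence algebra: under an all-scales rate, a drift with slope `s` ⟺ the geometric tube about `s` -/

section Seq

variable {b : ℕ → ℝ} {κ θ : ℝ}

/-- [folklore] **A DRIFT PINS EVERY TERM INTO THE TUBE, WITH THE SAME CONSTANT**: `AllScalesSeq b κ θ`, `θ < 1` and `OneLoopDrift s A b` give
`|b j − s| ≤ κ·θ^j` for every `j` (the constructed limit is `s` by Cesàro — `CauchyRate.lim_eq_of_drift` — and the two-ended all-scales shape gives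
`GeomRate b (lim b) κ θ` — `AllScalesSeq.geomRate`). -/
theorem abs_sub_le_of_allScales_drift (hall : AllScalesSeq b κ θ) (hθ1 : θ < 1) {s A : ℝ} (hA : Drift.OneLoopDrift s A b) (j : ℕ) :
    |b j - s| ≤ κ * θ ^ j := by
  have h := hall.geomRate hθ1 j
  rwa [hall.cauchyRate.lim_eq_of_drift hθ1 hA] at h

/-- [folklore] **DRIFT ⟺ TUBE** under an all-scales rate (`0 ≤ θ < 1`): `(∃ A, OneLoopDrift s A b) ↔ ∀ j, |b j − s| ≤ κ·θ^j`
(⇐ is `Drift.drift_of_geometric`, defect `κ∕(1−θ)`). -/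
theorem drift_iff_forall_abs_sub_le (hall : AllScalesSeq b κ θ) (hθ0 : 0 ≤ θ) (hθ1 : θ < 1) (s : ℝ) :
    (∃ A : ℝ, Drift.OneLoopDrift s A b) ↔ ∀ j : ℕ, |b j - s| ≤ κ * θ ^ j :=
  ⟨fun ⟨_, hA⟩ j => abs_sub_le_of_allScales_drift hall hθ1 hA j,
    fun h => ⟨κ / (1 - θ), Drift.drift_of_geometric hθ0 hθ1 hall.const_nonneg h⟩⟩

/-- [folklore] **THE REFUTATION SOCKET**: ONE index `j` with `κ·θ^j < |b j − s|` kills every drift with slope `s`. -/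
theorem not_drift_of_gap (hall : AllScalesSeq b κ θ) (hθ1 : θ < 1) {s : ℝ} {j : ℕ} (hgap : κ * θ ^ j < |b j - s|) :
    ¬ ∃ A : ℝ, Drift.OneLoopDrift s A b :=
  fun ⟨_, hA⟩ => absurd (abs_sub_le_of_allScales_drift hall hθ1 hA j) (not_le.mpr hgap)

/-- [folklore] **THE ENGINE's INTERVAL**: a drift with slope `s` places `s` in `[b j − κθ^j, b j + κθ^j]` for EVERY `j` — the width `2κθ^j` is positive at
every finite depth, which is why a VALUE identity is refutable but never certifiable by finitely many terms. -/
theorem mem_Icc_of_allScales_drift (hall : AllScalesSeq b κ θ) (hθ1 : θ < 1) {s A : ℝ} (hA : Drift.OneLoopDrift s A b) (j : ℕ) :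
    s ∈ Set.Icc (b j - κ * θ ^ j) (b j + κ * θ ^ j) := by
  have h := abs_le.mp (abs_sub_le_of_allScales_drift hall hθ1 hA j)
  exact ⟨by linarith [h.2], by linarith [h.1]⟩

/-- [folklore] **ONE-ENDED (CAUCHY) CURRENCY**: a Cauchy rate `|b (k+1) − b k| ≤ c·θ^k` («what a comparison of consecutive scales delivers»,
`RateCertificate.CauchyRate`) is the all-scales shape with budget `c∕(1−θ)` (`RemainderConstAllScales.allScalesSeq_of_cauchyRate`), so the tube and the
refutation socket read with `κ := c∕(1−θ)`. -/
theorem drift_iff_forall_abs_sub_le_of_cauchyRate {c : ℝ} (h : CauchyRate b c θ) (hθ0 : 0 ≤ θ) (hθ1 : θ < 1) (s : ℝ) :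
    (∃ A : ℝ, Drift.OneLoopDrift s A b) ↔ ∀ j : ℕ, |b j - s| ≤ c / (1 - θ) * θ ^ j :=
  drift_iff_forall_abs_sub_le (RemainderConstAllScales.allScalesSeq_of_cauchyRate h hθ0 hθ1) hθ0 hθ1 s

/-- [folklore] … and ONE index with `(c∕(1−θ))·θ^j < |b j − s|` refutes the drift. -/
theorem not_drift_of_gap_of_cauchyRate {c : ℝ} (h : CauchyRate b c θ) (hθ0 : 0 ≤ θ) (hθ1 : θ < 1) {s : ℝ} {j : ℕ}
    (hgap : c / (1 - θ) * θ ^ j < |b j - s|) : ¬ ∃ A : ℝ, Drift.OneLoopDrift s A b :=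
  not_drift_of_gap (RemainderConstAllScales.allScalesSeq_of_cauchyRate h hθ0 hθ1) hθ1 hgap

end Seq

/-! ## §2 At any jet family: the (D1) value sockets -/

section AnyJs

variable {Lc : ℕ} [NeZero Lc]

/-- [folklore] **(D1) ⟺ THE TUBE ABOUT THE PRINTED SLOPE** (any `Js`; the all-scales rate of the step coefficients as a displayed hypothesis — row G-an2-4's
shape): `D1Drift Lc Js N μ ν ↔ ∀ j, |secondMoment (TbalOf Lc Js j) μ ν − stepBal N Lc| ≤ κ·θ^j`.  Companion of the lead lineage's
`HessKerDressedCauchy.d1Drift_iff_lim_eq` (the limit currency). -/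
theorem d1Drift_iff_forall_abs_sub_stepBal_le (Js : ℕ → JetData 3 Lc) {μ ν : Fin 4} {κ θ : ℝ}
    (hall : AllScalesSeq (fun j => secondMoment (TbalOf Lc Js j) μ ν) κ θ) (hθ0 : 0 ≤ θ) (hθ1 : θ < 1) (N : ℝ) :
    D1Drift Lc Js N μ ν ↔ ∀ j : ℕ, |secondMoment (TbalOf Lc Js j) μ ν - B12Normalization.stepBal N Lc| ≤ κ * θ ^ j :=
  drift_iff_forall_abs_sub_le hall hθ0 hθ1 _

/-- [folklore] **EVERY STEP COEFFICIENT IN THE TUBE** from (D1) and the all-scales rate. -/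
theorem abs_secondMoment_sub_stepBal_le_of_d1Drift (Js : ℕ → JetData 3 Lc) {μ ν : Fin 4} {κ θ : ℝ}
    (hall : AllScalesSeq (fun j => secondMoment (TbalOf Lc Js j) μ ν) κ θ) (hθ1 : θ < 1) {N : ℝ} (hD : D1Drift Lc Js N μ ν) (j : ℕ) :
    |secondMoment (TbalOf Lc Js j) μ ν - B12Normalization.stepBal N Lc| ≤ κ * θ ^ j := by
  obtain ⟨A, hA⟩ := hD
  exact abs_sub_le_of_allScales_drift hall hθ1 hA j

/-- [folklore] **THE (D1) REFUTATION SOCKET**: given the all-scales rate, ONE scale `j` with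
`κ·θ^j < |secondMoment (TbalOf Lc Js j) μ ν − stepBal N Lc|` (a certified enclosure suffices) gives `¬ D1Drift Lc Js N μ ν`. -/
theorem not_d1Drift_of_gap (Js : ℕ → JetData 3 Lc) {μ ν : Fin 4} {κ θ : ℝ}
    (hall : AllScalesSeq (fun j => secondMoment (TbalOf Lc Js j) μ ν) κ θ) (hθ1 : θ < 1) {N : ℝ} {j : ℕ}
    (hgap : κ * θ ^ j < |secondMoment (TbalOf Lc Js j) μ ν - B12Normalization.stepBal N Lc|) : ¬ D1Drift Lc Js N μ ν :=
  fun hD => absurd (abs_secondMoment_sub_stepBal_le_of_d1Drift Js hall hθ1 hD j) (not_le.mpr hgap)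

/-- [folklore] **THE FIRST-STEP TEST OF (D1)**: the scale-0 coefficient sits within `κ` of `(11N²∕12π²)·log Lc`. -/
theorem abs_secondMoment_zero_sub_stepBal_le_of_d1Drift (Js : ℕ → JetData 3 Lc) {μ ν : Fin 4} {κ θ : ℝ}
    (hall : AllScalesSeq (fun j => secondMoment (TbalOf Lc Js j) μ ν) κ θ) (hθ1 : θ < 1) {N : ℝ} (hD : D1Drift Lc Js N μ ν) :
    |secondMoment (TbalOf Lc Js 0) μ ν - B12Normalization.stepBal N Lc| ≤ κ := by
  simpa using abs_secondMoment_sub_stepBal_le_of_d1Drift Js hall hθ1 hD 0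

/-- [folklore] … and `κ < |β⁰_0 − stepBal N Lc|` refutes (D1). -/
theorem not_d1Drift_of_gap_zero (Js : ℕ → JetData 3 Lc) {μ ν : Fin 4} {κ θ : ℝ}
    (hall : AllScalesSeq (fun j => secondMoment (TbalOf Lc Js j) μ ν) κ θ) (hθ1 : θ < 1) {N : ℝ}
    (hgap : κ < |secondMoment (TbalOf Lc Js 0) μ ν - B12Normalization.stepBal N Lc|) : ¬ D1Drift Lc Js N μ ν :=
  fun hD => absurd (abs_secondMoment_zero_sub_stepBal_le_of_d1Drift Js hall hθ1 hD) (not_le.mpr hgap)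

/-- [folklore] **THE ENGINE's INTERVAL FOR THE SLOPE**: (D1) places `stepBal N Lc` in `[β⁰_j − κθ^j, β⁰_j + κθ^j]` for every `j`. -/
theorem stepBal_mem_Icc_of_d1Drift (Js : ℕ → JetData 3 Lc) {μ ν : Fin 4} {κ θ : ℝ}
    (hall : AllScalesSeq (fun j => secondMoment (TbalOf Lc Js j) μ ν) κ θ) (hθ1 : θ < 1) {N : ℝ} (hD : D1Drift Lc Js N μ ν) (j : ℕ) :
    B12Normalization.stepBal N Lc ∈
      Set.Icc (secondMoment (TbalOf Lc Js j) μ ν - κ * θ ^ j) (secondMoment (TbalOf Lc Js j) μ ν + κ * θ ^ j) := by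
  obtain ⟨A, hA⟩ := hD
  exact mem_Icc_of_allScales_drift hall hθ1 hA j

/-- [folklore] **THE (D1) REFUTATION SOCKET IN ONE-ENDED CURRENCY**: a Cauchy rate of the step coefficients (`|β⁰_{j+1} − β⁰_j| ≤ c·θ^j`, e.g. from a symbol
step rate via `RateCertificate.SymbolStepRate.cauchyRate`) and ONE scale with `(c∕(1−θ))·θ^j < |β⁰_j − stepBal N Lc|` give `¬ D1Drift Lc Js N μ ν`. -/
theorem not_d1Drift_of_gap_of_cauchyRate (Js : ℕ → JetData 3 Lc) {μ ν : Fin 4} {c θ : ℝ}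
    (h : CauchyRate (fun j => secondMoment (TbalOf Lc Js j) μ ν) c θ) (hθ0 : 0 ≤ θ) (hθ1 : θ < 1) {N : ℝ} {j : ℕ}
    (hgap : c / (1 - θ) * θ ^ j < |secondMoment (TbalOf Lc Js j) μ ν - B12Normalization.stepBal N Lc|) : ¬ D1Drift Lc Js N μ ν :=
  not_d1Drift_of_gap Js (RemainderConstAllScales.allScalesSeq_of_cauchyRate h hθ0 hθ1) hθ1 hgap

end AnyJs

/-! ## §2′ The one-shot law's own mean reading (any `Lc`, any composite family; no row needed) -/

section OneShot

variable {Lc : ℕ} [NeZero Lc]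

/-- [folklore] **`OneShotLaw` ⟹ THE ONE-SHOT COEFFICIENT PER STEP CONVERGES TO THE PRINTED SLOPE**: `|secondMoment (TshotOf Lc Jc m) μ ν − stepBal N Lc·m| ≤ U`
for all `m ≥ 1` gives `secondMoment (TshotOf Lc Jc m) μ ν ∕ m → stepBal N Lc` (`|·∕m − s| ≤ U∕m`).  The engine-facing MEAN form of the exact missing lemma
(one-shot kernels at the composite blocks `Lc^m`); no rate, no junction. -/
theorem tendsto_secondMoment_TshotOf_div_of_oneShotLaw (Jc : ∀ m : ℕ, JetData 3 (Lc ^ m)) {N : ℝ} {μ ν : Fin 4}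
    (hlaw : OneShotLaw Lc Jc N μ ν) :
    Tendsto (fun m : ℕ => secondMoment (TshotOf Lc Jc m) μ ν / (m : ℝ)) atTop (𝓝 (B12Normalization.stepBal N Lc)) := by
  obtain ⟨U, hU⟩ := hlaw
  refine tendsto_sub_nhds_zero_iff.mp (squeeze_zero_norm' ?_ (tendsto_const_div_atTop_nhds_zero_nat U))
  filter_upwards [eventually_ge_atTop 1] with m hm
  have hmpos : (0 : ℝ) < m := by exact_mod_cast hm
  have h1 : secondMoment (TshotOf Lc Jc m) μ ν / (m : ℝ) - B12Normalization.stepBal N Lc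
      = (secondMoment (TshotOf Lc Jc m) μ ν - B12Normalization.stepBal N Lc * m) / (m : ℝ) := by
    field_simp
  rw [Real.norm_eq_abs, h1, abs_div, abs_of_pos hmpos]
  exact div_le_div_of_nonneg_right (hU m hm) hmpos.le

end OneShot

/-! ## §3 At the (III′) literal of record, in `OneShotLaw` currency (the junction `D1RoadsJunctionPinned` §4 called) -/

section Record

variable {Lc : ℕ} [NeZero Lc]

/-- [folklore] **THE EXACT READ-OUT AT THE `Jc` OF RECORD** (this lineage's `D1RoadsJunction.readout_eq_of_D1Tel_T0T1` fed with road FP's #30d (T0)(T1) at the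
locks and #31 `d1Tel_JcOfTabs_of_stepRecursion_wStep_pinned`): under the level-1 locks and an4's `StepRecursion`, for every `m ≥ 1`
`Σ_{j<m} secondMoment (TbalOf Lc Js j) μ ν = secondMoment (TshotOf Lc (JcOfTabs hLc N tabs cΛ cB) m) μ ν` — the partial sums of the (III′) step coefficients
ARE the one-shot second moments of the composite family of record (U′ = 0). -/
theorem sum_secondMoment_eq_secondMoment_TshotOf_of_stepRecursion (hLc : Odd Lc) (hL2 : 2 ≤ Lc) {N : ℕ} (hN : 2 ≤ N) (cΛ cB : ℕ → ℝ)
    (hΛ : cΛ 1 * (Lc : ℝ) ^ 4 = 2) (hcB : cB 1 = -((Lc : ℝ) ^ 12 / 4)) (tabs : ∀ m : ℕ, SymTables 3 (Lc ^ m))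
    (h1 : HEq (tabs 1) (symTablesAn1S2 3 Lc (cΛ 1)))
    (hrec : StepRecursion Lc (TbalOf Lc (JsB12CombShSym hLc N (symTablesAn1S2 3 Lc (cΛ 1)) (cΛ 1) (cB 1))) (TshotOf Lc (JcOfTabs hLc N tabs cΛ cB))
      (wStep Lc)) (μ ν : Fin 4) {m : ℕ} (hm : 1 ≤ m) :
    ∑ j ∈ range m, secondMoment (TbalOf Lc (JsB12CombShSym hLc N (symTablesAn1S2 3 Lc (cΛ 1)) (cΛ 1) (cB 1)) j) μ ν =
      secondMoment (TshotOf Lc (JcOfTabs hLc N tabs cΛ cB) m) μ ν :=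
  readout_eq_of_D1Tel_T0T1 _ _ (stepT0_JsB12CombShSym_an1S2_pinned hLc hL2 hN (cΛ 1) (cB 1) hΛ hcB)
    (stepT1_JsB12CombShSym_an1S2_pinned hLc hL2 hN (cΛ 1) (cB 1) hΛ hcB)
    (d1Tel_JcOfTabs_of_stepRecursion_wStep_pinned hLc hL2 hN cΛ cB hΛ hcB tabs h1 hrec) μ ν hm

/-- [folklore] **THE ONE-SHOT SECOND MOMENT OF THE FAMILY OF RECORD DRIFTS LINEARLY WITH THE CONSTRUCTED SLOPE — UNCONDITIONALLY IN THE VALUE**: given the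
step recursion and row G-an2-4's all-scales rate, for every `m ≥ 1`
`|secondMoment (TshotOf Lc (JcOfTabs hLc N tabs cΛ cB) m) μ ν − (CauchyRate.lim β⁰)·m| ≤ κ∕(1−θ)`.  So the WHOLE content of `OneShotLaw` beyond the two rows
is the single number `CauchyRate.lim β⁰ = (11N²∕12π²)·log Lc` (next theorem). -/
theorem abs_secondMoment_TshotOf_sub_lim_mul_le_of_stepRecursion (hLc : Odd Lc) (hL2 : 2 ≤ Lc) {N : ℕ} (hN : 2 ≤ N) (cΛ cB : ℕ → ℝ)
    (hΛ : cΛ 1 * (Lc : ℝ) ^ 4 = 2) (hcB : cB 1 = -((Lc : ℝ) ^ 12 / 4)) (tabs : ∀ m : ℕ, SymTables 3 (Lc ^ m))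
    (h1 : HEq (tabs 1) (symTablesAn1S2 3 Lc (cΛ 1)))
    (hrec : StepRecursion Lc (TbalOf Lc (JsB12CombShSym hLc N (symTablesAn1S2 3 Lc (cΛ 1)) (cΛ 1) (cB 1))) (TshotOf Lc (JcOfTabs hLc N tabs cΛ cB))
      (wStep Lc)) {μ ν : Fin 4} {κ θ : ℝ}
    (hall : AllScalesSeq (fun j => secondMoment (TbalOf Lc (JsB12CombShSym hLc N (symTablesAn1S2 3 Lc (cΛ 1)) (cΛ 1) (cB 1)) j) μ ν) κ θ)
    (hθ0 : 0 ≤ θ) (hθ1 : θ < 1) {m : ℕ} (hm : 1 ≤ m) :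
    |secondMoment (TshotOf Lc (JcOfTabs hLc N tabs cΛ cB) m) μ ν -
        CauchyRate.lim (fun j => secondMoment (TbalOf Lc (JsB12CombShSym hLc N (symTablesAn1S2 3 Lc (cΛ 1)) (cΛ 1) (cB 1)) j) μ ν) * m|
      ≤ κ / (1 - θ) := by
  rw [← sum_secondMoment_eq_secondMoment_TshotOf_of_stepRecursion hLc hL2 hN cΛ cB hΛ hcB tabs h1 hrec μ ν hm]
  exact oneLoopDrift_lim hall hθ0 hθ1 m

/-- [folklore] **THE EXACT MISSING LEMMA IN LIMIT CURRENCY AT THE LITERAL OF RECORD**: given the step recursion and the all-scales rate,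
`OneShotLaw Lc (JcOfTabs hLc N tabs cΛ cB) Nc μ ν ↔ CauchyRate.lim β⁰ = stepBal Nc Lc` (the junction + the lead's `HessKerDressedCauchy.d1Drift_iff_lim_eq`). -/
theorem oneShotLaw_iff_lim_eq_of_stepRecursion (hLc : Odd Lc) (hL2 : 2 ≤ Lc) {N : ℕ} (hN : 2 ≤ N) (cΛ cB : ℕ → ℝ)
    (hΛ : cΛ 1 * (Lc : ℝ) ^ 4 = 2) (hcB : cB 1 = -((Lc : ℝ) ^ 12 / 4)) (tabs : ∀ m : ℕ, SymTables 3 (Lc ^ m))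
    (h1 : HEq (tabs 1) (symTablesAn1S2 3 Lc (cΛ 1)))
    (hrec : StepRecursion Lc (TbalOf Lc (JsB12CombShSym hLc N (symTablesAn1S2 3 Lc (cΛ 1)) (cΛ 1) (cB 1))) (TshotOf Lc (JcOfTabs hLc N tabs cΛ cB))
      (wStep Lc)) {Nc : ℝ} {μ ν : Fin 4} {κ θ : ℝ}
    (hall : AllScalesSeq (fun j => secondMoment (TbalOf Lc (JsB12CombShSym hLc N (symTablesAn1S2 3 Lc (cΛ 1)) (cΛ 1) (cB 1)) j) μ ν) κ θ)
    (hθ0 : 0 ≤ θ) (hθ1 : θ < 1) :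
    OneShotLaw Lc (JcOfTabs hLc N tabs cΛ cB) Nc μ ν ↔
      CauchyRate.lim (fun j => secondMoment (TbalOf Lc (JsB12CombShSym hLc N (symTablesAn1S2 3 Lc (cΛ 1)) (cΛ 1) (cB 1)) j) μ ν) =
        B12Normalization.stepBal Nc Lc :=
  (d1Drift_record_iff_oneShotLaw_of_stepRecursion_tabs hLc hL2 hN cΛ cB hΛ hcB tabs h1 hrec).symm.trans (d1Drift_iff_lim_eq _ hall hθ0 hθ1 Nc)

/-- [folklore] **THE EXACT MISSING LEMMA ⟺ THE TUBE**: under the level-1 locks, for the `Jc` of record `JcOfTabs hLc N tabs cΛ cB` over ANY scale-indexed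
table record anchored on an1's at depth 1, an4's `StepRecursion` (ONE hypothesis) and row G-an2-4's all-scales rate of the (III′) step coefficients:
`OneShotLaw Lc (JcOfTabs hLc N tabs cΛ cB) Nc μ ν ↔ ∀ j, |secondMoment (TbalOf Lc Js j) μ ν − stepBal Nc Lc| ≤ κ·θ^j`. -/
theorem oneShotLaw_iff_forall_abs_sub_stepBal_le_of_stepRecursion (hLc : Odd Lc) (hL2 : 2 ≤ Lc) {N : ℕ} (hN : 2 ≤ N) (cΛ cB : ℕ → ℝ)
    (hΛ : cΛ 1 * (Lc : ℝ) ^ 4 = 2) (hcB : cB 1 = -((Lc : ℝ) ^ 12 / 4)) (tabs : ∀ m : ℕ, SymTables 3 (Lc ^ m))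
    (h1 : HEq (tabs 1) (symTablesAn1S2 3 Lc (cΛ 1)))
    (hrec : StepRecursion Lc (TbalOf Lc (JsB12CombShSym hLc N (symTablesAn1S2 3 Lc (cΛ 1)) (cΛ 1) (cB 1))) (TshotOf Lc (JcOfTabs hLc N tabs cΛ cB))
      (wStep Lc)) {Nc : ℝ} {μ ν : Fin 4} {κ θ : ℝ}
    (hall : AllScalesSeq (fun j => secondMoment (TbalOf Lc (JsB12CombShSym hLc N (symTablesAn1S2 3 Lc (cΛ 1)) (cΛ 1) (cB 1)) j) μ ν) κ θ)
    (hθ0 : 0 ≤ θ) (hθ1 : θ < 1) :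
    OneShotLaw Lc (JcOfTabs hLc N tabs cΛ cB) Nc μ ν ↔
      ∀ j : ℕ, |secondMoment (TbalOf Lc (JsB12CombShSym hLc N (symTablesAn1S2 3 Lc (cΛ 1)) (cΛ 1) (cB 1)) j) μ ν - B12Normalization.stepBal Nc Lc|
        ≤ κ * θ ^ j :=
  (d1Drift_record_iff_oneShotLaw_of_stepRecursion_tabs hLc hL2 hN cΛ cB hΛ hcB tabs h1 hrec).symm.trans
    (d1Drift_iff_forall_abs_sub_stepBal_le _ hall hθ0 hθ1 Nc)

/-- [folklore] **THE `OneShotLaw` REFUTATION SOCKET AT THE LITERAL OF RECORD**: ONE scale `j` with the (III′) step coefficient outside the tube kills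
the one-shot law of the composite family of record (given the step recursion and the all-scales rate). -/
theorem not_oneShotLaw_of_gap_of_stepRecursion (hLc : Odd Lc) (hL2 : 2 ≤ Lc) {N : ℕ} (hN : 2 ≤ N) (cΛ cB : ℕ → ℝ)
    (hΛ : cΛ 1 * (Lc : ℝ) ^ 4 = 2) (hcB : cB 1 = -((Lc : ℝ) ^ 12 / 4)) (tabs : ∀ m : ℕ, SymTables 3 (Lc ^ m))
    (h1 : HEq (tabs 1) (symTablesAn1S2 3 Lc (cΛ 1)))
    (hrec : StepRecursion Lc (TbalOf Lc (JsB12CombShSym hLc N (symTablesAn1S2 3 Lc (cΛ 1)) (cΛ 1) (cB 1))) (TshotOf Lc (JcOfTabs hLc N tabs cΛ cB))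
      (wStep Lc)) {Nc : ℝ} {μ ν : Fin 4} {κ θ : ℝ}
    (hall : AllScalesSeq (fun j => secondMoment (TbalOf Lc (JsB12CombShSym hLc N (symTablesAn1S2 3 Lc (cΛ 1)) (cΛ 1) (cB 1)) j) μ ν) κ θ)
    (hθ0 : 0 ≤ θ) (hθ1 : θ < 1) {j : ℕ}
    (hgap : κ * θ ^ j <
      |secondMoment (TbalOf Lc (JsB12CombShSym hLc N (symTablesAn1S2 3 Lc (cΛ 1)) (cΛ 1) (cB 1)) j) μ ν - B12Normalization.stepBal Nc Lc|) :
    ¬ OneShotLaw Lc (JcOfTabs hLc N tabs cΛ cB) Nc μ ν := fun hlaw =>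
  absurd ((oneShotLaw_iff_forall_abs_sub_stepBal_le_of_stepRecursion hLc hL2 hN cΛ cB hΛ hcB tabs h1 hrec hall hθ0 hθ1).mp hlaw j)
    (not_le.mpr hgap)

/-- [folklore] **THE ONE-STEP READING**: the one-shot law of the family of record (given the step recursion and the all-scales rate) already pins its
`m = 1` member — the one-shot kernel AT BLOCK `Lc` — to within the all-scales constant `κ` of the printed slope:
`|secondMoment (TshotOf Lc (JcOfTabs hLc N tabs cΛ cB) 1) μ ν − stepBal Nc Lc| ≤ κ` (an2's anchor `TshotOf_JcOfTabs_one`: the m = 1 one-shot kernel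
IS the scale-0 step kernel). -/
theorem abs_secondMoment_TshotOf_one_sub_stepBal_le_of_oneShotLaw (hLc : Odd Lc) (hL2 : 2 ≤ Lc) {N : ℕ} (hN : 2 ≤ N) (cΛ cB : ℕ → ℝ)
    (hΛ : cΛ 1 * (Lc : ℝ) ^ 4 = 2) (hcB : cB 1 = -((Lc : ℝ) ^ 12 / 4)) (tabs : ∀ m : ℕ, SymTables 3 (Lc ^ m))
    (h1 : HEq (tabs 1) (symTablesAn1S2 3 Lc (cΛ 1)))
    (hrec : StepRecursion Lc (TbalOf Lc (JsB12CombShSym hLc N (symTablesAn1S2 3 Lc (cΛ 1)) (cΛ 1) (cB 1))) (TshotOf Lc (JcOfTabs hLc N tabs cΛ cB))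
      (wStep Lc)) {Nc : ℝ} {μ ν : Fin 4} {κ θ : ℝ}
    (hall : AllScalesSeq (fun j => secondMoment (TbalOf Lc (JsB12CombShSym hLc N (symTablesAn1S2 3 Lc (cΛ 1)) (cΛ 1) (cB 1)) j) μ ν) κ θ)
    (hθ0 : 0 ≤ θ) (hθ1 : θ < 1) (hlaw : OneShotLaw Lc (JcOfTabs hLc N tabs cΛ cB) Nc μ ν) :
    |secondMoment (TshotOf Lc (JcOfTabs hLc N tabs cΛ cB) 1) μ ν - B12Normalization.stepBal Nc Lc| ≤ κ := by
  have h := (oneShotLaw_iff_forall_abs_sub_stepBal_le_of_stepRecursion hLc hL2 hN cΛ cB hΛ hcB tabs h1 hrec hall hθ0 hθ1).mp hlaw 0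
  rw [TshotOf_JcOfTabs_one hLc N tabs cΛ cB _ h1]
  simpa using h

/-- [folklore] **THE ONE-SHOT-CURRENCY TUBE AT THE LITERAL OF RECORD**: given the step recursion and the all-scales rate, the one-shot law forces, for every
`m ≥ 1`, `|secondMoment (TshotOf Lc (JcOfTabs hLc N tabs cΛ cB) m) μ ν − stepBal Nc Lc·m| ≤ κ∕(1−θ)` — the `∃ U` of `Gaps.D1Residue.OneShotLaw` made EXPLICIT
(`U = κ∕(1−θ)`: tube ⟹ `Drift.drift_of_geometric` ⟹ the exact read-out). -/
theorem abs_secondMoment_TshotOf_sub_stepBal_mul_le_of_oneShotLaw (hLc : Odd Lc) (hL2 : 2 ≤ Lc) {N : ℕ} (hN : 2 ≤ N) (cΛ cB : ℕ → ℝ)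
    (hΛ : cΛ 1 * (Lc : ℝ) ^ 4 = 2) (hcB : cB 1 = -((Lc : ℝ) ^ 12 / 4)) (tabs : ∀ m : ℕ, SymTables 3 (Lc ^ m))
    (h1 : HEq (tabs 1) (symTablesAn1S2 3 Lc (cΛ 1)))
    (hrec : StepRecursion Lc (TbalOf Lc (JsB12CombShSym hLc N (symTablesAn1S2 3 Lc (cΛ 1)) (cΛ 1) (cB 1))) (TshotOf Lc (JcOfTabs hLc N tabs cΛ cB))
      (wStep Lc)) {Nc : ℝ} {μ ν : Fin 4} {κ θ : ℝ}
    (hall : AllScalesSeq (fun j => secondMoment (TbalOf Lc (JsB12CombShSym hLc N (symTablesAn1S2 3 Lc (cΛ 1)) (cΛ 1) (cB 1)) j) μ ν) κ θ)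
    (hθ0 : 0 ≤ θ) (hθ1 : θ < 1) (hlaw : OneShotLaw Lc (JcOfTabs hLc N tabs cΛ cB) Nc μ ν) {m : ℕ} (hm : 1 ≤ m) :
    |secondMoment (TshotOf Lc (JcOfTabs hLc N tabs cΛ cB) m) μ ν - B12Normalization.stepBal Nc Lc * m| ≤ κ / (1 - θ) := by
  have htube := (oneShotLaw_iff_forall_abs_sub_stepBal_le_of_stepRecursion hLc hL2 hN cΛ cB hΛ hcB tabs h1 hrec hall hθ0 hθ1).mp hlaw
  have hdrift := Drift.drift_of_geometric hθ0 hθ1 hall.const_nonneg htube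
  rw [← sum_secondMoment_eq_secondMoment_TshotOf_of_stepRecursion hLc hL2 hN cΛ cB hΛ hcB tabs h1 hrec μ ν hm]
  exact hdrift m

/-- [folklore] **THE ONE-SHOT-CURRENCY REFUTATION SOCKET**: ONE composite block `Lc^m` (`m ≥ 1`) at which the one-shot second moment of the family of record sits
farther than `κ∕(1−θ)` from `m·(11Nc²∕12π²)·log Lc` kills `OneShotLaw` (given the step recursion and the all-scales rate). -/
theorem not_oneShotLaw_of_oneShot_gap_of_stepRecursion (hLc : Odd Lc) (hL2 : 2 ≤ Lc) {N : ℕ} (hN : 2 ≤ N) (cΛ cB : ℕ → ℝ)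
    (hΛ : cΛ 1 * (Lc : ℝ) ^ 4 = 2) (hcB : cB 1 = -((Lc : ℝ) ^ 12 / 4)) (tabs : ∀ m : ℕ, SymTables 3 (Lc ^ m))
    (h1 : HEq (tabs 1) (symTablesAn1S2 3 Lc (cΛ 1)))
    (hrec : StepRecursion Lc (TbalOf Lc (JsB12CombShSym hLc N (symTablesAn1S2 3 Lc (cΛ 1)) (cΛ 1) (cB 1))) (TshotOf Lc (JcOfTabs hLc N tabs cΛ cB))
      (wStep Lc)) {Nc : ℝ} {μ ν : Fin 4} {κ θ : ℝ}
    (hall : AllScalesSeq (fun j => secondMoment (TbalOf Lc (JsB12CombShSym hLc N (symTablesAn1S2 3 Lc (cΛ 1)) (cΛ 1) (cB 1)) j) μ ν) κ θ)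
    (hθ0 : 0 ≤ θ) (hθ1 : θ < 1) {m : ℕ} (hm : 1 ≤ m)
    (hgap : κ / (1 - θ) < |secondMoment (TshotOf Lc (JcOfTabs hLc N tabs cΛ cB) m) μ ν - B12Normalization.stepBal Nc Lc * m|) :
    ¬ OneShotLaw Lc (JcOfTabs hLc N tabs cΛ cB) Nc μ ν := fun hlaw =>
  absurd (abs_secondMoment_TshotOf_sub_stepBal_mul_le_of_oneShotLaw hLc hL2 hN cΛ cB hΛ hcB tabs h1 hrec hall hθ0 hθ1 hlaw hm) (not_le.mpr hgap)

end Record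

/-! ## §4 Witness: a VALUE identity is refutable but NOT certifiable from finitely many coefficients (the SIGN∕VALUE dichotomy, kernel-checked) -/

section Witness

/-- [folklore] **NON-CERTIFIABILITY WITNESS.**  For every all-scales budget `κ > 0`, rate `0 < θ < 1`, slope `s` and depth `J` there are two real sequences
with the SAME all-scales shape `AllScalesSeq · κ θ` and the SAME first `J + 1` terms, one drifting with slope `s` and one NOT: the constant sequence `s`,
and the sequence equal to `s` up to depth `J` and to `s + κ·θ^{J+1}` beyond.  So no finite list of (even exact) step coefficients, together with the
all-scales shape alone, implies (D1) — in contrast with the CAP SIGN list (`Gaps/CapTailPinnedLimitSign`, `RateCertificate.GeomRate.smallKCert`), which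
finitely many certified values DO settle.  Pure sequence algebra; nothing of Bałaban's. -/
theorem exists_allScales_agree_drift_and_not_drift {κ θ : ℝ} (hκ : 0 < κ) (hθ0 : 0 < θ) (hθ1 : θ < 1) (s : ℝ) (J : ℕ) :
    ∃ b b' : ℕ → ℝ, AllScalesSeq b κ θ ∧ AllScalesSeq b' κ θ ∧ (∀ j, j ≤ J → b j = b' j) ∧
      (∃ A : ℝ, Drift.OneLoopDrift s A b) ∧ ¬ ∃ A : ℝ, Drift.OneLoopDrift s A b' := by
  set η : ℝ := κ * θ ^ (J + 1) with hη
  have hηpos : 0 < η := by positivity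
  -- the perturbed sequence: `s` up to depth `J`, `s + η` beyond
  set b' : ℕ → ℝ := fun j => if j ≤ J then s else s + η with hb'
  have hall' : AllScalesSeq b' κ θ := by
    intro k j
    have hslack : 0 ≤ κ * θ ^ k := by positivity
    by_cases hkj : k + j ≤ J
    · have hk : k ≤ J := by omega
      have e1 : b' (k + j) = s := by simp only [hb', hkj, if_true]
      have e2 : b' k = s := by simp only [hb', hk, if_true]
      rw [e1, e2, sub_self, abs_zero]
      exact hslack
    · by_cases hk : k ≤ J
      · have hpow : θ ^ (J + 1) ≤ θ ^ k := pow_le_pow_of_le_one hθ0.le hθ1.le (by omega)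
        have e1 : b' (k + j) = s + η := by simp only [hb', hkj, if_false]
        have e2 : b' k = s := by simp only [hb', hk, if_true]
        rw [e1, e2, add_sub_cancel_left, abs_of_pos hηpos, hη]
        exact mul_le_mul_of_nonneg_left hpow hκ.le
      · have hkj' : ¬ (k + j ≤ J) := hkj
        have e1 : b' (k + j) = s + η := by simp only [hb', hkj', if_false]
        have e2 : b' k = s + η := by simp only [hb', hk, if_false]
        rw [e1, e2, sub_self, abs_zero]
        exact hslack
  refine ⟨fun _ => s, b', ?_, hall', ?_, ?_, ?_⟩
  · intro k j
    have : 0 ≤ κ * θ ^ k := by positivity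
    simpa using this
  · intro j hj
    simp [hb', hj]
  · refine ⟨0, fun k => ?_⟩
    simp [Finset.sum_const, Finset.card_range, nsmul_eq_mul, mul_comm]
  · rintro ⟨A, hA⟩
    -- `b'` is eventually the constant `s + η`, so its constructed limit is `s + η`; a drift with slope `s` would force that limit to be `s`
    have htend : Tendsto b' atTop (𝓝 (s + η)) :=
      tendsto_const_nhds.congr' (by
        filter_upwards [eventually_gt_atTop J] with j hj
        simp [hb', not_le.mpr hj])
    have h1 : s + η = CauchyRate.lim b' := hall'.cauchyRate.eq_lim hθ1 htend
    have h2 : CauchyRate.lim b' = s := hall'.cauchyRate.lim_eq_of_drift hθ1 hA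
    linarith

end Witness

end Summit.QuantumFields.BalabanUV.Gaps.D1ValueSockets

end
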